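import Summits.Ventures.HSemireg.WedgeHankelSubstitutionSemisimpleMinpoly

/-!
# Venture HSemireg — THE TORUS ELEMENT `SbC(1 0 0 t)` ON TH-7's CLASSES HAS MINIMAL POLYNOMIAL OF DEGREE `min(n+1, ord t)`: the number of distinct weights `t^0, …, t^n` is
# `min(n+1, ord t)` (`ord t` = the multiplicative order of `t ≠ 0`, `n + 1` when `t` has infinite order), and the powers `t^0, …, t^n` are pairwise distinct iff `t` has
# infinite order or `ord t > n` — the bridge between K2 (minimal polynomials) and K3/K9 (the hypothesis «`t` with `n + 1` distinct powers»)

HONEST FRAMING. Part of the Lean index of the computation cell `pub-hsemireg` (seat p10 gen 21, Sunday typer «UNIFORM-IN-n»).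
Finite-dimensional EXTERIOR ALGEBRA + linear algebra + elementary group theory of `orderOf` ONLY: no variety, no cohomology theory, no sheaf, no Ext group, no
semiregularity map; nothing here says that HC / HC_CM / HC_AV holds; no Literature fact is declared or used.  Custodian versions as in `WedgeHankelSiegelIdeal` (1/3) and
`WedgeHankelFrameChange`; the dictionary (the torus weights of `Sym^n` are `t^p`) is QUOTED, never asserted.

WHAT IS IN THE TREE.  K2 (`WedgeHankelSubstitutionSemisimpleMinpoly`, this seat): `minpoly_SbC_diag` (the product of `X − μ` over the DISTINCT `a^{n−p}d^p`),
`natDegree_minpoly_SbC_of_upper`; K3 (`WedgeHankelClassSpaceIrreducibleCharP`): the criteria under the hypothesis `Function.Injective fun q : Fin (n+1) => t^q`; Mathlib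
`pow_eq_pow_iff_modEq`, `pow_mod_orderOf`, `orderOf_units`.  THIS FILE (namespace `Summit.Ventures.HSemireg.Wedge.HankelFrameChange` continued; imports K2, tree since 20:29Z):
* §292 `pow_eq_pow_iff_modEq_orderOf` (field version through `Units.mk0`), **`pow_injective_iff_orderOf`** (`t ≠ 0`: `t^0, …, t^n` pairwise distinct ⇔ `orderOf t = 0 ∨ n < orderOf t`),
  `image_pow_eq_image_range_min`, **`card_image_pow_eq`** (`t ≠ 0` of finite order: `#{t^p : p ≤ n} = min(n+1, orderOf t)`), `card_image_pow_eq_of_orderOf_eq_zero` (`= n + 1`).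
* §293 **`natDegree_minpoly_SbC_torus`: `deg minpoly (SbC(1 0 0 t)) = min(n+1, orderOf t)`** for `t ≠ 0` of finite order, **`natDegree_minpoly_SbC_torus_of_orderOf_eq_zero`**
  (`= n + 1`: then `minpoly = charpoly`, `minpoly_SbC_torus_eq_charpoly_of_orderOf_eq_zero`), `natDegree_minpoly_SbC_torus_le` (`≤ orderOf t` when finite: e.g. `SbC(1 0 0 (−1))`
  has `minpoly` of degree `≤ 2`).
NOT typed here: `t = 0` (a singular substitution, J1/J10); two general fixed nodes (the ratio `(α+λ₂γ)/(α+λ₁γ)` plays the role of `t`); anything Ext-side.  New names only.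
-/

open Module

namespace Summit.Ventures.HSemireg.Wedge.HankelFrameChange

open Summit.Ventures.HSemireg.Wedge Summit.Ventures.HSemireg.Wedge.Kunneth Summit.Ventures.HSemireg.Wedge.Hankel
  Summit.Ventures.HSemireg.Wedge.BasisFree Summit.Ventures.HSemireg.Wedge.HankelSiegel Summit.Ventures.HSemireg.Wedge.HankelSiegelIdeal
  Summit.Ventures.HSemireg.Wedge.KunnethKernel Summit.Ventures.HSemireg.Wedge.HankelRankOne Summit.Ventures.HSemireg.Wedge.KernelDuality

variable (K : Type*) [Field K] {n : ℕ}

/-! ## §292. Distinct powers and the multiplicative order -/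

omit [Field K] in
/-- field version of `pow_eq_pow_iff_modEq`: for `t ≠ 0`, `t^a = t^b ⇔ a ≡ b [MOD orderOf t]` (through the unit `Units.mk0 t`). -/
theorem pow_eq_pow_iff_modEq_orderOf (K : Type*) [Field K] {t : K} (ht : t ≠ 0) (a b : ℕ) : t ^ a = t ^ b ↔ a ≡ b [MOD orderOf t] := by
  have hu : ((Units.mk0 t ht : Kˣ) : K) = t := rfl
  rw [← hu, ← Units.val_pow_eq_pow_val, ← Units.val_pow_eq_pow_val, Units.val_inj, pow_eq_pow_iff_modEq, orderOf_units]

omit [Field K] in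
/-- **for `t ≠ 0`: the powers `t^0, t^1, …, t^n` are pairwise distinct iff `t` has infinite order or order `> n`.** -/
theorem pow_injective_iff_orderOf (K : Type*) [Field K] {t : K} (ht : t ≠ 0) (n : ℕ) :
    (Function.Injective fun q : Fin (n + 1) => t ^ (q : ℕ)) ↔ orderOf t = 0 ∨ n < orderOf t := by
  constructor
  · intro h
    by_contra hc
    rw [not_or, not_lt] at hc
    -- `t^{orderOf t} = t^0` with `0 < orderOf t ≤ n`
    have e : (fun q : Fin (n + 1) => t ^ (q : ℕ)) ⟨orderOf t, by omega⟩ = (fun q : Fin (n + 1) => t ^ (q : ℕ)) ⟨0, by omega⟩ := by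
      simp only [pow_orderOf_eq_one, pow_zero]
    have := congrArg Fin.val (h e)
    simp only at this
    exact hc.1 this
  · intro h i j e
    change t ^ (i : ℕ) = t ^ (j : ℕ) at e
    rw [pow_eq_pow_iff_modEq_orderOf K ht] at e
    apply Fin.ext
    rcases h with h0 | hlt
    · rwa [h0, Nat.modEq_zero_iff] at e
    · have hi := Nat.mod_eq_of_lt (lt_of_le_of_lt (Nat.le_of_lt_succ i.2) hlt)
      have hj := Nat.mod_eq_of_lt (lt_of_le_of_lt (Nat.le_of_lt_succ j.2) hlt)
      unfold Nat.ModEq at e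
      rwa [hi, hj] at e

/-- the distinct powers among `t^0, …, t^n` are those among `t^0, …, t^{m−1}`, `m = min(n+1, orderOf t)` (finite order: `t^k = t^{k mod ord}`). -/
theorem image_pow_eq_image_range_min [DecidableEq K] {t : K} (hord : 0 < orderOf t) :
    Finset.univ.image (fun q : Fin (n + 1) => t ^ (q : ℕ)) = (Finset.range (min (n + 1) (orderOf t))).image fun k => t ^ k := by
  ext x
  simp only [Finset.mem_image, Finset.mem_univ, true_and, Finset.mem_range, lt_min_iff]
  constructor
  · rintro ⟨q, rfl⟩
    refine ⟨(q : ℕ) % orderOf t, ⟨lt_of_le_of_lt (Nat.mod_le _ _) q.2, Nat.mod_lt _ hord⟩, pow_mod_orderOf t q⟩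
  · rintro ⟨k, ⟨hk, -⟩, rfl⟩
    exact ⟨⟨k, hk⟩, rfl⟩

/-- **`t ≠ 0` of finite order: `#{t^p : p ≤ n} = min(n+1, orderOf t)`.** -/
theorem card_image_pow_eq [DecidableEq K] {t : K} (ht : t ≠ 0) (hord : 0 < orderOf t) :
    (Finset.univ.image fun q : Fin (n + 1) => t ^ (q : ℕ)).card = min (n + 1) (orderOf t) := by
  rw [image_pow_eq_image_range_min K hord, Finset.card_image_of_injOn, Finset.card_range]
  intro a ha b hb e
  rw [Finset.coe_range, Set.mem_Iio, lt_min_iff] at ha hb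
  have e' := (pow_eq_pow_iff_modEq_orderOf K ht a b).mp e
  unfold Nat.ModEq at e'
  rwa [Nat.mod_eq_of_lt ha.2, Nat.mod_eq_of_lt hb.2] at e'

/-- **`t ≠ 0` of infinite order: `#{t^p : p ≤ n} = n + 1`.** -/
theorem card_image_pow_eq_of_orderOf_eq_zero [DecidableEq K] {t : K} (ht : t ≠ 0) (hord : orderOf t = 0) :
    (Finset.univ.image fun q : Fin (n + 1) => t ^ (q : ℕ)).card = n + 1 := by
  rw [Finset.card_image_of_injective _ ((pow_injective_iff_orderOf K ht n).mpr (Or.inl hord)), Finset.card_univ, Fintype.card_fin]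

/-! ## §293. The degree of the minimal polynomial of the torus element -/

/-- the weights of `SbC(1 0 0 t)` are `t^p` (`1^{n−p}·t^p`). -/
theorem torus_weights_eq (t : K) : (fun q : Fin (n + 1) => (1 : K) ^ (n - (q : ℕ)) * t ^ (q : ℕ)) = fun q : Fin (n + 1) => t ^ (q : ℕ) := by
  funext q; rw [one_pow, one_mul]

/-- **`deg minpoly (SbC(1 0 0 t)) = min(n+1, orderOf t)` for `t ≠ 0` OF FINITE ORDER** on th-7's classes (K2: the degree is the number of distinct weights). -/
theorem natDegree_minpoly_SbC_torus {t : K} (ht : t ≠ 0) (hord : 0 < orderOf t) : (minpoly K (SbC K 1 0 0 t (n := n))).natDegree = min (n + 1) (orderOf t) := by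
  classical
  rw [natDegree_minpoly_SbC_of_upper K (l₁ := 0) (by rw [zero_mul, zero_mul, add_zero]), torus_weights_eq, card_image_pow_eq K ht hord]

/-- **`deg minpoly (SbC(1 0 0 t)) = n + 1` for `t ≠ 0` OF INFINITE ORDER** (all `n + 1` weights distinct). -/
theorem natDegree_minpoly_SbC_torus_of_orderOf_eq_zero {t : K} (ht : t ≠ 0) (hord : orderOf t = 0) : (minpoly K (SbC K 1 0 0 t (n := n))).natDegree = n + 1 := by
  classical
  rw [natDegree_minpoly_SbC_of_upper K (l₁ := 0) (by rw [zero_mul, zero_mul, add_zero]), torus_weights_eq, card_image_pow_eq_of_orderOf_eq_zero K ht hord]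

/-- then `minpoly = charpoly` (degree `n + 1 = dim`; both monic, `minpoly ∣ charpoly`). -/
theorem minpoly_SbC_torus_eq_charpoly_of_orderOf_eq_zero {t : K} (ht : t ≠ 0) (hord : orderOf t = 0) :
    minpoly K (SbC K 1 0 0 t (n := n)) = (SbC K 1 0 0 t (n := n)).charpoly := by
  have hT : IsIntegral K (SbC K 1 0 0 t (n := n)) := Algebra.IsIntegral.isIntegral _
  refine (Polynomial.eq_of_monic_of_dvd_of_natDegree_le (minpoly.monic hT) (LinearMap.charpoly_monic _) (minpoly.dvd K _ (LinearMap.aeval_self_charpoly _)) ?_).symm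
  rw [natDegree_minpoly_SbC_torus_of_orderOf_eq_zero K ht hord, LinearMap.charpoly_natDegree, finrank_eq_card_basis (spikeBasis K n), Fintype.card_fin]

/-- `t ≠ 0` of finite order: `deg minpoly (SbC(1 0 0 t)) ≤ orderOf t` whatever `n` (e.g. `t = −1`, `2 ≠ 0`: degree `≤ 2`, K2 `minpoly_SbC_diag_neg` for the sign twist). -/
theorem natDegree_minpoly_SbC_torus_le {t : K} (ht : t ≠ 0) (hord : 0 < orderOf t) : (minpoly K (SbC K 1 0 0 t (n := n))).natDegree ≤ orderOf t := by
  rw [natDegree_minpoly_SbC_torus K ht hord]; exact min_le_right _ _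

end Summit.Ventures.HSemireg.Wedge.HankelFrameChange
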